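import Mathlib.Analysis.Complex.Periodic
import Literature.Analysis.Calculus.LocalInverseOnCompact
import HarnessLib

/-!
# Periodic holomorphic maps through `q = e^{2πiz/T}`; the holomorphic chart along a totally real
# analytic annulus

Classical complex analysis (topic `Analysis/Complex`, companion of `RealAnalyticExtension.lean`),
proofs plus two explicit definitions.

**(1) Vector-valued `q`-lift.**  Mathlib's `Function.Periodic.cuspFunction` turns a `T`-periodic
holomorphic `f : ℂ → ℂ` into a holomorphic function of `q = 𝕢 T z = e^{2πiz/T}`
(`differentiableAt_cuspFunction`).  Here the same local-inverse argument is recorded for maps with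
values in a complex Banach space `E`, away from `q = 0`: `qLift T F = F ∘ invQParam T`,
`qLift_qParam` (`qLift T F (𝕢 T z) = F z` for periodic `F`), `differentiableAt_qLift`.

**(2) The collar map.**  For two `T`-periodic holomorphic maps `FK Fν : ℂ → E` (the holomorphic
extensions of a real-analytic closed curve `K` and of a real-analytic vector field `ν` along it,
`RealAnalyticExtension.lean`), the map

  `collarMap T FK Fν (q, η) = qLift T FK q + η • qLift T Fν q`

is complex-differentiable at the points `(𝕢 T z, η)` (`differentiableAt_collarMap`) and `C^∞`
over `ℂ` on `liftRegion T δ × ℂ`, `liftRegion T δ = 𝕢 T (strip |Im z| < δ)` the open annulus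
(`differentiableOn_qLift`, `analyticOnNhd_qLift`, `contDiffOn_collarMap`, `isOpen_liftRegion`,
`qParam_ofReal_mem_liftRegion`), and restricts on `{(𝕢 T σ, t) : σ, t ∈ ℝ}` to the real collar
`(σ, t) ↦ K σ + t ν σ` (`collarMap_qParam_ofReal`).

**(3) The holomorphic chart** (`exists_collarChart`): if the collar map is injective on a compact
set `C` of the annulus × `ℂ` (embeddedness of the real collar annulus) and its complex derivative is
invertible there (total reality: `K'(σ)` and `ν(σ)` are `ℂ`-linearly independent, `dim_ℂ E = 2`),
then it restricts to a biholomorphism between an open neighbourhood of `C` and an open subset of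
`E` — by the holomorphic inverse function theorem globalised along a compact set,
`Literature/Analysis/Calculus/LocalInverseOnCompact.lean`.  This is the chart in which a
real-analytic totally real annulus of `ℂ²` becomes the flat annulus `S¹ × [a, b] ⊂ ℂ* × ℝ`
(Forstnerič–Kozak 2003, §4: *"M can be locally flattened near any point p ∈ bM by a local
biholomorphic change of coordinates"*, here along the whole circle at once), the gluing /
flattening chart of the seat of `Literature.Geometry.Symplectic.palf_stein_supportedByBoundaryOpenBook`.

Everything is proved; definitions `qLift`, `collarMap`, `liftRegion` (explicit formulas), no named fact.

## References

* F. Forstnerič, J. Kozak, *Strongly pseudoconvex handlebodies*, J. Korean Math. Soc. 40 (2003),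
  §4 (arXiv:math/0305237, p. 3). [ForstnericKozak2003]
* S. G. Krantz, H. R. Parks, *A Primer of Real Analytic Functions*, 2nd ed. (2002), §1.2.
  [KrantzParks2002]
-/

open Set Function Filter Topology Complex
open scoped Real ContDiff

noncomputable section

namespace Literature.Analysis.Complex

open Function.Periodic

variable {E : Type*} [NormedAddCommGroup E] [NormedSpace ℂ E]

/-! ### The vector-valued `q`-lift -/

/-- **The `q`-lift** of `F : ℂ → E`: `qLift T F q = F (invQParam T q)`,
`invQParam T q = (T / 2πi) log q`. [folklore] -/
def qLift (T : ℝ) (F : ℂ → E) (q : ℂ) : E :=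
  F (invQParam T q)

omit [NormedAddCommGroup E] [NormedSpace ℂ E] in
/-- Unfolding. [folklore] -/
theorem qLift_apply (T : ℝ) (F : ℂ → E) (q : ℂ) : qLift T F q = F (invQParam T q) := rfl

omit [NormedAddCommGroup E] [NormedSpace ℂ E] in
/-- For a `T`-periodic `F`: `qLift T F (𝕢 T z) = F z`. [folklore] -/
theorem qLift_qParam {T : ℝ} (hT : T ≠ 0) {F : ℂ → E} (hper : Periodic F T) (z : ℂ) :
    qLift T F (qParam T z) = F z := by
  obtain ⟨m, hm⟩ := qParam_left_inv_mod_period hT z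
  rw [qLift_apply, hm]
  exact hper.int_mul m z

/-- The `q`-parameter has the non-zero strict derivative `𝕢 T z · (2πi/T)`. [folklore] -/
theorem hasStrictDerivAt_qParam {T : ℝ} (z : ℂ) :
    HasStrictDerivAt (qParam T) (qParam T z * (2 * π * I / T)) z := by
  simpa only [id_eq, mul_one] using! (((hasStrictDerivAt_id z).const_mul _).div_const _).cexp

/-- The derivative of the `q`-parameter does not vanish (`T ≠ 0`). [folklore] -/
theorem qParam_mul_ne_zero {T : ℝ} (hT : T ≠ 0) (z : ℂ) : qParam T z * (2 * π * I / T) ≠ 0 :=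
  mul_ne_zero (Complex.exp_ne_zero _) (div_ne_zero two_pi_I_ne_zero (by exact_mod_cast hT))

/-- **The `q`-lift of a periodic map is complex-differentiable at `𝕢 T z` when `F` is at `z`**
(vector-valued version of Mathlib's `Function.Periodic.differentiableAt_cuspFunction`; the local
inverse of `𝕢 T` at `z` is differentiable and `qLift T F = F ∘` it near `𝕢 T z`). [folklore] -/
theorem differentiableAt_qLift {T : ℝ} (hT : T ≠ 0) {F : ℂ → E} (hper : Periodic F T) {z : ℂ}
    (hF : DifferentiableAt ℂ F z) : DifferentiableAt ℂ (qLift T F) (qParam T z) := by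
  set q := qParam T z with hq
  have qdiff : HasStrictDerivAt (qParam T) (q * (2 * π * I / T)) z := hasStrictDerivAt_qParam z
  have diff_ne : q * (2 * π * I / T) ≠ 0 := qParam_mul_ne_zero hT z
  set L := qdiff.localInverse (qParam T) _ z diff_ne with hL
  have diff_L : DifferentiableAt ℂ L q :=
    (qdiff.to_localInverse diff_ne).hasStrictFDerivAt.differentiableAt
  have hLinv : qParam T ∘ L =ᶠ[𝓝 q] (id : ℂ → ℂ) :=
    (qdiff.hasStrictFDerivAt_equiv diff_ne).eventually_right_inverse
  -- near `q`, `qLift T F = F ∘ L`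
  have hF' : qLift T F =ᶠ[𝓝 q] F ∘ L := by
    filter_upwards [hLinv] with q' hq'
    simp only [Function.comp_apply, id_eq] at hq'
    rw [Function.comp_apply, ← qLift_qParam hT hper (L q'), hq']
  -- `L q = z`
  have hLq : L q = z := (qdiff.hasStrictFDerivAt_equiv diff_ne).eventually_left_inverse.self_of_nhds
  have hFz : DifferentiableAt ℂ F (L q) := by rw [hLq]; exact hF
  exact (hFz.comp q diff_L).congr_of_eventuallyEq hF'

/-- The image of the real axis: `𝕢 T σ = e^{2πiσ/T}` has norm `1`. [folklore] -/
theorem norm_qParam_ofReal (T σ : ℝ) : ‖qParam T σ‖ = 1 := by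
  rw [norm_qParam]
  simp

/-! ### The collar map -/

/-- **The collar map** `(q, η) ↦ qLift T FK q + η • qLift T Fν q`. [cite: ForstnericKozak2003, §4] -/
def collarMap (T : ℝ) (FK Fν : ℂ → E) (p : ℂ × ℂ) : E :=
  qLift T FK p.1 + p.2 • qLift T Fν p.1

/-- Unfolding. [folklore] -/
theorem collarMap_apply (T : ℝ) (FK Fν : ℂ → E) (p : ℂ × ℂ) :
    collarMap T FK Fν p = qLift T FK p.1 + p.2 • qLift T Fν p.1 := rfl

/-- **On the real collar**: for `T`-periodic `FK`, `Fν` extending `K`, `ν` on the real axis,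
`collarMap T FK Fν (𝕢 T σ, t) = K σ + t • ν σ`. [folklore] -/
theorem collarMap_qParam_ofReal {T : ℝ} (hT : T ≠ 0) {FK Fν : ℂ → E} (hK : Periodic FK T)
    (hν : Periodic Fν T) {K ν : ℝ → E} (hFK : ∀ s : ℝ, FK s = K s) (hFν : ∀ s : ℝ, Fν s = ν s)
    (σ t : ℝ) : collarMap T FK Fν (qParam T σ, (t : ℂ)) = K σ + (t : ℝ) • ν σ := by
  rw [collarMap_apply]
  simp only
  rw [qLift_qParam hT hK, qLift_qParam hT hν, hFK, hFν, Complex.coe_smul]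

/-- More generally `collarMap T FK Fν (𝕢 T z, η) = FK z + η • Fν z`. [folklore] -/
theorem collarMap_qParam {T : ℝ} (hT : T ≠ 0) {FK Fν : ℂ → E} (hK : Periodic FK T)
    (hν : Periodic Fν T) (z η : ℂ) : collarMap T FK Fν (qParam T z, η) = FK z + η • Fν z := by
  rw [collarMap_apply]
  simp only
  rw [qLift_qParam hT hK, qLift_qParam hT hν]

/-- **The collar map is complex-differentiable at `(𝕢 T z, η)`** when `FK`, `Fν` are periodic and
differentiable at `z`. [folklore] -/
theorem differentiableAt_collarMap {T : ℝ} (hT : T ≠ 0) {FK Fν : ℂ → E} (hK : Periodic FK T)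
    (hν : Periodic Fν T) {z : ℂ} (hFK : DifferentiableAt ℂ FK z) (hFν : DifferentiableAt ℂ Fν z)
    (η : ℂ) : DifferentiableAt ℂ (collarMap T FK Fν) (qParam T z, η) := by
  have h1 : DifferentiableAt ℂ (fun p : ℂ × ℂ => qLift T FK p.1) (qParam T z, η) :=
    DifferentiableAt.comp (g := qLift T FK) (f := Prod.fst) (qParam T z, η)
      (differentiableAt_qLift hT hK hFK) differentiableAt_fst
  have h2 : DifferentiableAt ℂ (fun p : ℂ × ℂ => qLift T Fν p.1) (qParam T z, η) :=
    DifferentiableAt.comp (g := qLift T Fν) (f := Prod.fst) (qParam T z, η)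
      (differentiableAt_qLift hT hν hFν) differentiableAt_fst
  have h3 : DifferentiableAt ℂ (fun p : ℂ × ℂ => p.2 • qLift T Fν p.1) (qParam T z, η) :=
    differentiableAt_snd.smul h2
  exact h1.add h3

/-- Every point of the annulus `{q ≠ 0}` is a `𝕢 T z`. [folklore] -/
theorem exists_qParam_eq {T : ℝ} (hT : T ≠ 0) {q : ℂ} (hq : q ≠ 0) : ∃ z : ℂ, qParam T z = q :=
  ⟨invQParam T q, qParam_right_inv hT hq⟩

/-! ### The lifting region: the annulus over the strip `|Im z| < δ` -/

/-- **The lifting region** `{q ≠ 0 : |Im (invQParam T q)| < δ}`: the open annulus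
`e^{-2π δ/|T|} < |q| < e^{2π δ/|T|}`, image of the strip `|Im z| < δ` under `𝕢 T`. [folklore] -/
def liftRegion (T δ : ℝ) : Set ℂ :=
  {q : ℂ | q ≠ 0 ∧ |(invQParam T q).im| < δ}

omit [NormedAddCommGroup E] [NormedSpace ℂ E] in
/-- Membership. [folklore] -/
theorem mem_liftRegion {T δ : ℝ} {q : ℂ} :
    q ∈ liftRegion T δ ↔ q ≠ 0 ∧ |(invQParam T q).im| < δ := Iff.rfl

omit [NormedAddCommGroup E] [NormedSpace ℂ E] in
/-- Points of the lifting region lift into the strip. [folklore] -/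
theorem exists_qParam_eq_of_mem_liftRegion {T δ : ℝ} (hT : T ≠ 0) {q : ℂ} (hq : q ∈ liftRegion T δ) :
    ∃ z : ℂ, qParam T z = q ∧ |z.im| < δ :=
  ⟨invQParam T q, qParam_right_inv hT hq.1, hq.2⟩

omit [NormedAddCommGroup E] [NormedSpace ℂ E] in
/-- The lifting region is open. [folklore] -/
theorem isOpen_liftRegion (T δ : ℝ) : IsOpen (liftRegion T δ) := by
  have hcont : ContinuousOn (fun q : ℂ => |(invQParam T q).im|) {q | q ≠ 0} := by
    have h1 : (fun q : ℂ => (invQParam T q).im) = fun q => -T / (2 * π) * Real.log ‖q‖ := by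
      funext q
      rw [im_invQParam]
    have h2 : ContinuousOn (fun q : ℂ => (invQParam T q).im) {q | q ≠ 0} := by
      rw [h1]
      exact continuousOn_const.mul (continuous_norm.continuousOn.log fun q hq => norm_ne_zero_iff.2 hq)
    exact h2.abs
  have hopen : IsOpen {q : ℂ | q ≠ 0} := isOpen_ne
  exact hcont.isOpen_inter_preimage hopen (isOpen_Iio (a := δ))

omit [NormedAddCommGroup E] [NormedSpace ℂ E] in
/-- The unit circle (image of the real axis) lies in the lifting region when `0 < δ`. [folklore] -/
theorem qParam_ofReal_mem_liftRegion {T δ : ℝ} (hδ : 0 < δ) (σ : ℝ) : qParam T σ ∈ liftRegion T δ := by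
  refine ⟨Complex.exp_ne_zero _, ?_⟩
  rw [im_invQParam, norm_qParam_ofReal, Real.log_one, mul_zero, abs_zero]
  exact hδ

/-- **The `q`-lift of a strip-holomorphic periodic map is holomorphic on the lifting region.**
[folklore] -/
theorem differentiableOn_qLift {T δ : ℝ} (hT : T ≠ 0) {F : ℂ → E} (hper : Periodic F T)
    (hF : ∀ z : ℂ, |z.im| < δ → DifferentiableAt ℂ F z) :
    DifferentiableOn ℂ (qLift T F) (liftRegion T δ) := by
  intro q hq
  obtain ⟨z, hz, hzim⟩ := exists_qParam_eq_of_mem_liftRegion hT hq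
  have h := differentiableAt_qLift hT hper (hF z hzim)
  rw [hz] at h
  exact h.differentiableWithinAt

/-- Hence analytic there (one complex variable, complete target). [folklore] -/
theorem analyticOnNhd_qLift [CompleteSpace E] {T δ : ℝ} (hT : T ≠ 0) {F : ℂ → E}
    (hper : Periodic F T) (hF : ∀ z : ℂ, |z.im| < δ → DifferentiableAt ℂ F z) :
    AnalyticOnNhd ℂ (qLift T F) (liftRegion T δ) :=
  (differentiableOn_qLift hT hper hF).analyticOnNhd (isOpen_liftRegion T δ)

/-- **The collar map is holomorphic (`C^∞` over `ℂ`) on `liftRegion T δ × ℂ`.** [folklore] -/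
theorem contDiffOn_collarMap [CompleteSpace E] {T δ : ℝ} (hT : T ≠ 0) {FK Fν : ℂ → E}
    (hK : Periodic FK T) (hν : Periodic Fν T)
    (hFK : ∀ z : ℂ, |z.im| < δ → DifferentiableAt ℂ FK z)
    (hFν : ∀ z : ℂ, |z.im| < δ → DifferentiableAt ℂ Fν z) {n : WithTop ℕ∞} :
    ContDiffOn ℂ n (collarMap T FK Fν) (liftRegion T δ ×ˢ univ) := by
  have hA := (analyticOnNhd_qLift hT hK hFK).contDiffOn_of_completeSpace (n := n)
  have hB := (analyticOnNhd_qLift hT hν hFν).contDiffOn_of_completeSpace (n := n)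
  have hfst : MapsTo (Prod.fst : ℂ × ℂ → ℂ) (liftRegion T δ ×ˢ univ) (liftRegion T δ) :=
    fun p hp => hp.1
  have h1 : ContDiffOn ℂ n (fun p : ℂ × ℂ => qLift T FK p.1) (liftRegion T δ ×ˢ univ) :=
    hA.comp contDiffOn_fst hfst
  have h2 : ContDiffOn ℂ n (fun p : ℂ × ℂ => qLift T Fν p.1) (liftRegion T δ ×ˢ univ) :=
    hB.comp contDiffOn_fst hfst
  exact h1.add (contDiffOn_snd.smul h2)

/-! ### The holomorphic chart along the annulus -/

/-- **The holomorphic chart along a compact piece of the collar.**  Let `FK Fν : ℂ → E` be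
`T`-periodic and complex-differentiable on the strip `|Im z| < δ` (e.g. the holomorphic extensions
of a real-analytic closed curve and of a real-analytic vector field along it).  If the collar map
`(q, η) ↦ qLift T FK q + η • qLift T Fν q` is injective on a compact `C ⊆ liftRegion T δ × ℂ`
(embeddedness of the real collar annulus) and its complex derivative is invertible at the points of
`C` (total reality: `K'(σ) + t ν'(σ)` and `ν(σ)` are `ℂ`-independent, `dim_ℂ E = 2`), then it
restricts to a biholomorphism: an open partial homeomorphism `e : ℂ × ℂ ⇀ E` with
`⇑e = collarMap T FK Fν`, `C ⊆ e.source ⊆ liftRegion T δ × ℂ`, inverse holomorphic (`C^∞` over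
`ℂ`) on `e.target`, and derivative invertible on `e.source`.
[cite: ForstnericKozak2003, §4] -/
theorem exists_collarChart [CompleteSpace E] {T δ : ℝ} (hT : T ≠ 0) {FK Fν : ℂ → E}
    (hK : Periodic FK T) (hν : Periodic Fν T)
    (hFK : ∀ z : ℂ, |z.im| < δ → DifferentiableAt ℂ FK z)
    (hFν : ∀ z : ℂ, |z.im| < δ → DifferentiableAt ℂ Fν z)
    {C : Set (ℂ × ℂ)} (hC : IsCompact C) (hCW : C ⊆ liftRegion T δ ×ˢ univ)
    (hinj : InjOn (collarMap T FK Fν) C)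
    (hinv : ∀ p ∈ C, ∃ M : (ℂ × ℂ) ≃L[ℂ] E, (M : ℂ × ℂ →L[ℂ] E) = fderiv ℂ (collarMap T FK Fν) p) :
    ∃ e : OpenPartialHomeomorph (ℂ × ℂ) E, ⇑e = collarMap T FK Fν ∧ C ⊆ e.source ∧
      e.source ⊆ liftRegion T δ ×ˢ univ ∧ ContDiffOn ℂ ∞ e.symm e.target ∧
      ∀ p ∈ e.source, ∃ M : (ℂ × ℂ) ≃L[ℂ] E,
        HasFDerivAt (collarMap T FK Fν) (M : ℂ × ℂ →L[ℂ] E) p := by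
  set Φ := collarMap T FK Fν with hΦ
  set W : Set (ℂ × ℂ) := liftRegion T δ ×ˢ univ with hW
  have hWo : IsOpen W := (isOpen_liftRegion T δ).prod isOpen_univ
  have hcd : ContDiffOn ℂ ∞ Φ W := contDiffOn_collarMap hT hK hν hFK hFν
  have hcont : ContinuousOn (fun p => fderiv ℂ Φ p) W :=
    hcd.continuousOn_fderiv_of_isOpen hWo (by simp)
  -- shrink `W` to the open set where the derivative is invertible
  set W' : Set (ℂ × ℂ) := W ∩ (fun p => fderiv ℂ Φ p) ⁻¹'
    range ((↑) : ((ℂ × ℂ) ≃L[ℂ] E) → (ℂ × ℂ) →L[ℂ] E) with hW'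
  have hW'o : IsOpen W' := hcont.isOpen_inter_preimage hWo ContinuousLinearEquiv.isOpen
  have hCW' : C ⊆ W' := fun p hp => ⟨hCW hp, by
    obtain ⟨M, hM⟩ := hinv p hp
    exact ⟨M, hM⟩⟩
  have hder : ∀ p ∈ W', ∃ M : (ℂ × ℂ) ≃L[ℂ] E, HasFDerivAt Φ (M : ℂ × ℂ →L[ℂ] E) p := by
    rintro p ⟨hpW, M, hM⟩
    refine ⟨M, ?_⟩
    rw [hM]
    exact ((hcd.differentiableOn (by simp) p hpW).differentiableAt (hWo.mem_nhds hpW)).hasFDerivAt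
  obtain ⟨e, he, hCe, heW, hsymm⟩ :=
    Literature.Analysis.Calculus.exists_openPartialHomeomorph_contDiffOn_symm (𝕂 := ℂ) (n := ∞)
      (by simp) hW'o hCW' hC (hcd.mono inter_subset_left) hder hinj
  exact ⟨e, he, hCe, fun p hp => (heW hp).1, hsymm, fun p hp => hder p (heW hp)⟩

end Literature.Analysis.Complex

end
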